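import Mathlib
import Summits.SmoothPoincare4.SmoothPoincare4.Theorems.SoloInformedAnchorIdentities

/-!
# The lifted pretzel knot normally generates `π₁Σ(2,3,7)`: a kernel certificate that `π₁(𝔐₀) = 1` (solo-informed, session s55)

Setting (HKM24 = Hughes–Kim–Miller, arXiv:2402.11706, Question 1.4; the residency's banked statement
`paper/doors-for-M0.md` §1, CLAIMS C398/C539/C626).  `Γ̃ := π₁Σ(2,3,7) = ⟨a, b ∣ a³ = (ab)² = b⁷ =: z⟩` (`z = h` the
regular fibre, central of infinite order), `Δ := Γ̃/⟨z⟩` the `(2,3,7)` triangle group, and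
`c := b⁻³ a b⁻¹ a b⁻³ a ∈ Γ̃` the class of the lifted branch knot `K̃ ⊂ Σ(2,3,7) = Σ₂(S³, P(−2,3,7))`
(C398; the word called `η` in `SoloInformedAnchorIdentities`).  The homotopy 4-sphere of Question 1.4 is the open book
`𝔐₀ = Σ₂(S⁴, ρ¹P(−2,3,7)) = X(Push^fr(c)·τ_∂) = (Σ(2,3,7)° ×_φ S¹) ∪ S² × D²`, whose fundamental group is
`Γ̃ / ⟨⟨ g⁻¹ φ_*(g) ⟩⟩ = Γ̃ / ⟨⟨ [c, a], [c, b] ⟩⟩` (`φ_*` = conjugation by `c`; the sphere twist `τ_∂` acts trivially on `π₁`).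

This file certifies, INSIDE Lean and for ANY group, the three group-theoretic facts behind "`𝔐₀` is simply connected":

* `SoloInformed_triangle237_killC` — `a³ = 1, abab = 1, b⁷ = 1, c = 1 ⊢ a = b = 1`: the image `c̄` normally generates `Δ`.
  The proof is a Knuth–Bendix derivation (49 rules, 110 elementary rewrite steps; found by `work/s55/kbproof.py`,
  re-checked by `work/s55/verify_kb.py`) replayed step by step: every `have rK : ∀ w, L·w = R·w` is one derived rule, every
  `calc` step one application of an earlier rule inside a word (`congrArg` on the prefix context).
* `SoloInformed_gammaTilde_killC` — `a³ = abab = b⁷ = z, c = 1 ⊢ a = b = z = 1`: `c` normally generates `Γ̃` (a WEIGHT element;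
  this is the kernel form of the GAP evidence "η, ηh are weight elements", CLAIMS C612(ii)).  Reduction to the first theorem:
  pass to the centralizer `C` of `z` (which contains `a, b` since `z` is central in `⟨a, b⟩`, `SoloInformed_anchor_za/zb`) and to
  `C ⧸ Z(C)`, where `z ↦ 1`; the first theorem puts `a, b` in `Z(C)`, so `ab = ba`, and an abelian `(2,3,7)`-pair is trivial
  (`SoloInformed_comm237_collapse`).
* `SoloInformed_pi1_openBook_c_trivial` — `a³ = abab = b⁷ = z, [c, a] = [c, b] = 1 ⊢ a = b = 1`, i.e.
  `Γ̃ / ⟨⟨[c, Γ̃]⟩⟩ = 1`: the presentation-level statement `π₁ X(Push(c)) = π₁ X(Push(c)·τ_∂) = 1` for BOTH members of the pair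
  `{X(η), X(ηh)} = {S⁴, 𝔐₀}` (C626).  Same reduction with the centralizer of `c`, using the second theorem in the quotient.

Nothing topological is asserted in Lean: the dictionary `π₁X(φ) = Γ̃/⟨⟨g⁻¹φ_*(g)⟩⟩`, `Push(c)_* = (conjugation by c)` and the
word for `c` (C398, HKM24 Constr./Cor. 3.6 read in `π₀Diff⁺(Σ(2,3,7)°, ∂)`, C539) are the prose hypotheses; HKM24 prove that
`𝔐₀` is a homotopy 4-sphere topologically — this file is an independent algebraic certificate of its `π₁`-half.
-/

namespace Summit.SmoothPoincare4.SmoothPoincare4.Theorems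

/-! ### 1. `c̄` normally generates the `(2,3,7)` triangle group — the Knuth–Bendix certificate -/

section killC
variable {H : Type*} [Group H] {a b : H}

set_option maxHeartbeats 4000000 in
/-- KERNEL CERTIFICATE (Knuth–Bendix derivation, 49 rules / 110 elementary steps, `work/s55/kbproof.py`,
independently re-checked by `work/s55/verify_kb.py`): in ANY group, `a³ = 1`, `abab = 1`, `b⁷ = 1` and
`c = 1` for the word `c = b⁻³ a b⁻¹ a b⁻³ a` force `a = b = 1`; i.e. the image `c̄` of the class of the lifted
pretzel knot NORMALLY GENERATES the `(2,3,7)` triangle group `Δ = ⟨a, b ∣ a³ = (ab)² = b⁷ = 1⟩ = Γ̃/⟨h⟩`. -/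
theorem SoloInformed_triangle237_killC (h0 : a * a * a = 1) (h1 : a * b * a * b = 1)
    (h2 : b * b * b * b * b * b * b = 1)
    (hc : b⁻¹ * b⁻¹ * b⁻¹ * a * b⁻¹ * a * b⁻¹ * b⁻¹ * b⁻¹ * a = 1) : a = 1 ∧ b = 1 := by
  have x_aA : ∀ w : H, (a * (a⁻¹ * w)) = w := fun w => mul_inv_cancel_left a w
  have x_Aa : ∀ w : H, (a⁻¹ * (a * w)) = w := fun w => inv_mul_cancel_left a w
  have x_bB : ∀ w : H, (b * (b⁻¹ * w)) = w := fun w => mul_inv_cancel_left b w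
  have x_Bb : ∀ w : H, (b⁻¹ * (b * w)) = w := fun w => inv_mul_cancel_left b w
  have x_aaa : ∀ w : H, (a * (a * (a * w))) = w := fun w => by
    calc (a * (a * (a * w))) = (a * a * a) * w := by simp only [mul_assoc]
      _ = w := by rw [h0, one_mul]
  have x_abab : ∀ w : H, (a * (b * (a * (b * w)))) = w := fun w => by
    calc (a * (b * (a * (b * w)))) = (a * b * a * b) * w := by simp only [mul_assoc]
      _ = w := by rw [h1, one_mul]
  have x_bbbbbbb : ∀ w : H, (b * (b * (b * (b * (b * (b * (b * w))))))) = w := fun w => by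
    calc (b * (b * (b * (b * (b * (b * (b * w))))))) = (b * b * b * b * b * b * b) * w := by simp only [mul_assoc]
      _ = w := by rw [h2, one_mul]
  have x_BBBaBaBBBa : ∀ w : H, (b⁻¹ * (b⁻¹ * (b⁻¹ * (a * (b⁻¹ * (a * (b⁻¹ * (b⁻¹ * (b⁻¹ * (a * w)))))))))) = w := fun w => by
    calc (b⁻¹ * (b⁻¹ * (b⁻¹ * (a * (b⁻¹ * (a * (b⁻¹ * (b⁻¹ * (b⁻¹ * (a * w)))))))))) = (b⁻¹ * b⁻¹ * b⁻¹ * a * b⁻¹ * a * b⁻¹ * b⁻¹ * b⁻¹ * a) * w := by simp only [mul_assoc]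
      _ = w := by rw [hc, one_mul]
  have r8 : ∀ w : H, (a * (a * w)) = (a⁻¹ * w) := fun w => by
    calc (a * (a * w))
        _ = (a * (a * (a * (a⁻¹ * w)))) := congrArg (fun t => (a * (a * t))) ((x_aA w).symm)
        _ = (a⁻¹ * w) := x_aaa (a⁻¹ * w)
  have r9 : ∀ w : H, (a⁻¹ * (a⁻¹ * w)) = (a * w) := fun w => by
    calc (a⁻¹ * (a⁻¹ * w))
        _ = (a⁻¹ * (a * (a * w))) := congrArg (fun t => (a⁻¹ * t)) ((r8 w).symm)
        _ = (a * w) := x_Aa (a * w)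
  have r10 : ∀ w : H, (a * (b * (a * w))) = (b⁻¹ * w) := fun w => by
    calc (a * (b * (a * w)))
        _ = (a * (b * (a * (b * (b⁻¹ * w))))) := congrArg (fun t => (a * (b * (a * t)))) ((x_bB w).symm)
        _ = (b⁻¹ * w) := x_abab (b⁻¹ * w)
  have r11 : ∀ w : H, (b * (a * w)) = (a⁻¹ * (b⁻¹ * w)) := fun w => by
    calc (b * (a * w))
        _ = (a⁻¹ * (a * (b * (a * w)))) := (x_Aa (b * (a * w))).symm
        _ = (a⁻¹ * (b⁻¹ * w)) := congrArg (fun t => (a⁻¹ * t)) (r10 w)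
  have r13 : ∀ w : H, (a⁻¹ * (b⁻¹ * (a⁻¹ * w))) = (b * w) := fun w => by
    calc (a⁻¹ * (b⁻¹ * (a⁻¹ * w)))
        _ = (b * (a * (a⁻¹ * w))) := (r11 (a⁻¹ * w)).symm
        _ = (b * w) := congrArg (fun t => (b * t)) (x_aA w)
  have r15 : ∀ w : H, (b⁻¹ * (a⁻¹ * w)) = (a * (b * w)) := fun w => by
    calc (b⁻¹ * (a⁻¹ * w))
        _ = (a * (a⁻¹ * (b⁻¹ * (a⁻¹ * w)))) := (x_aA (b⁻¹ * (a⁻¹ * w))).symm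
        _ = (a * (b * w)) := congrArg (fun t => (a * t)) (r13 w)
  have r16 : ∀ w : H, (a * (b * (a⁻¹ * w))) = (b⁻¹ * (a * w)) := fun w => by
    calc (a * (b * (a⁻¹ * w)))
        _ = (b⁻¹ * (a⁻¹ * (a⁻¹ * w))) := (r15 (a⁻¹ * w)).symm
        _ = (b⁻¹ * (a * w)) := congrArg (fun t => (b⁻¹ * t)) (r9 w)
  have r17 : ∀ w : H, (a⁻¹ * (b * (a⁻¹ * w))) = (a * (b⁻¹ * (a * w))) := fun w => by
    calc (a⁻¹ * (b * (a⁻¹ * w)))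
        _ = (a * (a * (b * (a⁻¹ * w)))) := (r8 (b * (a⁻¹ * w))).symm
        _ = (a * (b⁻¹ * (a * w))) := congrArg (fun t => (a * t)) (r16 w)
  have r18 : ∀ w : H, (b⁻¹ * (a * (b⁻¹ * (a * w)))) = (a * (b * (b * (a⁻¹ * w)))) := fun w => by
    calc (b⁻¹ * (a * (b⁻¹ * (a * w))))
        _ = (b⁻¹ * (a⁻¹ * (b * (a⁻¹ * w)))) := congrArg (fun t => (b⁻¹ * t)) ((r17 w).symm)
        _ = (a * (b * (b * (a⁻¹ * w)))) := r15 (b * (a⁻¹ * w))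
  have r19 : ∀ w : H, (b⁻¹ * (b⁻¹ * (a * (b * (b * (a⁻¹ * (b⁻¹ * (b⁻¹ * (b⁻¹ * (a * w)))))))))) = w := fun w => by
    calc (b⁻¹ * (b⁻¹ * (a * (b * (b * (a⁻¹ * (b⁻¹ * (b⁻¹ * (b⁻¹ * (a * w))))))))))
        _ = (b⁻¹ * (b⁻¹ * (b⁻¹ * (a * (b⁻¹ * (a * (b⁻¹ * (b⁻¹ * (b⁻¹ * (a * w)))))))))) := congrArg (fun t => (b⁻¹ * (b⁻¹ * t))) ((r18 (b⁻¹ * (b⁻¹ * (b⁻¹ * (a * w))))).symm)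
        _ = w := x_BBBaBaBBBa w
  have r20 : ∀ w : H, (b * (b * (b * (b * (b * (b * w)))))) = (b⁻¹ * w) := fun w => by
    calc (b * (b * (b * (b * (b * (b * w))))))
        _ = (b * (b * (b * (b * (b * (b * (b * (b⁻¹ * w)))))))) := congrArg (fun t => (b * (b * (b * (b * (b * (b * t))))))) ((x_bB w).symm)
        _ = (b⁻¹ * w) := x_bbbbbbb (b⁻¹ * w)
  have r21 : ∀ w : H, (b * (b * (b * (b * (b * w))))) = (b⁻¹ * (b⁻¹ * w)) := fun w => by
    calc (b * (b * (b * (b * (b * w)))))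
        _ = (b⁻¹ * (b * (b * (b * (b * (b * (b * w))))))) := (x_Bb (b * (b * (b * (b * (b * w)))))).symm
        _ = (b⁻¹ * (b⁻¹ * w)) := congrArg (fun t => (b⁻¹ * t)) (r20 w)
  have r22 : ∀ w : H, (b * (b * (b * (b * w)))) = (b⁻¹ * (b⁻¹ * (b⁻¹ * w))) := fun w => by
    calc (b * (b * (b * (b * w))))
        _ = (b⁻¹ * (b * (b * (b * (b * (b * w)))))) := (x_Bb (b * (b * (b * (b * w))))).symm
        _ = (b⁻¹ * (b⁻¹ * (b⁻¹ * w))) := congrArg (fun t => (b⁻¹ * t)) (r21 w)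
  have r23 : ∀ w : H, (b⁻¹ * (b⁻¹ * (b⁻¹ * (b⁻¹ * w)))) = (b * (b * (b * w))) := fun w => by
    calc (b⁻¹ * (b⁻¹ * (b⁻¹ * (b⁻¹ * w))))
        _ = (b⁻¹ * (b * (b * (b * (b * w))))) := congrArg (fun t => (b⁻¹ * t)) ((r22 w).symm)
        _ = (b * (b * (b * w))) := x_Bb (b * (b * (b * w)))
  have r24 : ∀ w : H, (b * (b * (b * (a⁻¹ * (b⁻¹ * w))))) = (b⁻¹ * (b⁻¹ * (b⁻¹ * (a * w)))) := fun w => by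
    calc (b * (b * (b * (a⁻¹ * (b⁻¹ * w)))))
        _ = (b * (b * (b * (b * (a * w))))) := congrArg (fun t => (b * (b * (b * t)))) ((r11 w).symm)
        _ = (b⁻¹ * (b⁻¹ * (b⁻¹ * (a * w)))) := r22 (a * w)
  have r28 : ∀ w : H, (b⁻¹ * (a * (b * (b * (a⁻¹ * (b⁻¹ * (b⁻¹ * (b⁻¹ * (a * w))))))))) = (b * w) := fun w => by
    calc (b⁻¹ * (a * (b * (b * (a⁻¹ * (b⁻¹ * (b⁻¹ * (b⁻¹ * (a * w)))))))))
        _ = (b * (b⁻¹ * (b⁻¹ * (a * (b * (b * (a⁻¹ * (b⁻¹ * (b⁻¹ * (b⁻¹ * (a * w))))))))))) := (x_bB (b⁻¹ * (a * (b * (b * (a⁻¹ * (b⁻¹ * (b⁻¹ * (b⁻¹ * (a * w)))))))))).symm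
        _ = (b * w) := congrArg (fun t => (b * t)) (r19 w)
  have r29 : ∀ w : H, (a * (b * (b * (a⁻¹ * (b⁻¹ * (b⁻¹ * (b⁻¹ * (a * w)))))))) = (b * (b * w)) := fun w => by
    calc (a * (b * (b * (a⁻¹ * (b⁻¹ * (b⁻¹ * (b⁻¹ * (a * w))))))))
        _ = (b * (b⁻¹ * (a * (b * (b * (a⁻¹ * (b⁻¹ * (b⁻¹ * (b⁻¹ * (a * w)))))))))) := (x_bB (a * (b * (b * (a⁻¹ * (b⁻¹ * (b⁻¹ * (b⁻¹ * (a * w))))))))).symm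
        _ = (b * (b * w)) := congrArg (fun t => (b * t)) (r28 w)
  have r30 : ∀ w : H, (b * (b * (a⁻¹ * (b⁻¹ * (b⁻¹ * (b⁻¹ * (a * w))))))) = (a⁻¹ * (b * (b * w))) := fun w => by
    calc (b * (b * (a⁻¹ * (b⁻¹ * (b⁻¹ * (b⁻¹ * (a * w)))))))
        _ = (a⁻¹ * (a * (b * (b * (a⁻¹ * (b⁻¹ * (b⁻¹ * (b⁻¹ * (a * w))))))))) := (x_Aa (b * (b * (a⁻¹ * (b⁻¹ * (b⁻¹ * (b⁻¹ * (a * w)))))))).symm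
        _ = (a⁻¹ * (b * (b * w))) := congrArg (fun t => (a⁻¹ * t)) (r29 w)
  have r31 : ∀ w : H, (b * (a⁻¹ * (b⁻¹ * (b⁻¹ * (b⁻¹ * (a * w)))))) = (a * (b * (b * (b * w)))) := fun w => by
    calc (b * (a⁻¹ * (b⁻¹ * (b⁻¹ * (b⁻¹ * (a * w))))))
        _ = (b⁻¹ * (b * (b * (a⁻¹ * (b⁻¹ * (b⁻¹ * (b⁻¹ * (a * w)))))))) := (x_Bb (b * (a⁻¹ * (b⁻¹ * (b⁻¹ * (b⁻¹ * (a * w))))))).symm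
        _ = (b⁻¹ * (a⁻¹ * (b * (b * w)))) := congrArg (fun t => (b⁻¹ * t)) (r30 w)
        _ = (a * (b * (b * (b * w)))) := r15 (b * (b * w))
  have r32 : ∀ w : H, (b⁻¹ * (a * (b * (b * (b * w))))) = (a⁻¹ * (b⁻¹ * (b⁻¹ * (b⁻¹ * (a * w))))) := fun w => by
    calc (b⁻¹ * (a * (b * (b * (b * w)))))
        _ = (b⁻¹ * (b * (a⁻¹ * (b⁻¹ * (b⁻¹ * (b⁻¹ * (a * w))))))) := congrArg (fun t => (b⁻¹ * t)) ((r31 w).symm)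
        _ = (a⁻¹ * (b⁻¹ * (b⁻¹ * (b⁻¹ * (a * w))))) := x_Bb (a⁻¹ * (b⁻¹ * (b⁻¹ * (b⁻¹ * (a * w)))))
  have r33 : ∀ w : H, (a⁻¹ * (b⁻¹ * (b⁻¹ * (b⁻¹ * (a * (b⁻¹ * w)))))) = (b⁻¹ * (a * (b * (b * w)))) := fun w => by
    calc (a⁻¹ * (b⁻¹ * (b⁻¹ * (b⁻¹ * (a * (b⁻¹ * w))))))
        _ = (b⁻¹ * (a * (b * (b * (b * (b⁻¹ * w)))))) := (r32 (b⁻¹ * w)).symm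
        _ = (b⁻¹ * (a * (b * (b * w)))) := congrArg (fun t => (b⁻¹ * (a * (b * (b * t))))) (x_bB w)
  have r36 : ∀ w : H, (b⁻¹ * (b⁻¹ * (b⁻¹ * (a * (b⁻¹ * w))))) = (a * (b⁻¹ * (a * (b * (b * w))))) := fun w => by
    calc (b⁻¹ * (b⁻¹ * (b⁻¹ * (a * (b⁻¹ * w)))))
        _ = (a * (a⁻¹ * (b⁻¹ * (b⁻¹ * (b⁻¹ * (a * (b⁻¹ * w))))))) := (x_aA (b⁻¹ * (b⁻¹ * (b⁻¹ * (a * (b⁻¹ * w)))))).symm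
        _ = (a * (b⁻¹ * (a * (b * (b * w))))) := congrArg (fun t => (a * t)) (r33 w)
  have r39 : ∀ w : H, (a⁻¹ * (b⁻¹ * (b⁻¹ * (a * (b * (b * w)))))) = (b⁻¹ * (b⁻¹ * (a * (b⁻¹ * w)))) := fun w => by
    calc (a⁻¹ * (b⁻¹ * (b⁻¹ * (a * (b * (b * w))))))
        _ = (b * (a * (b⁻¹ * (a * (b * (b * w)))))) := (r11 (b⁻¹ * (a * (b * (b * w))))).symm
        _ = (b * (b⁻¹ * (b⁻¹ * (b⁻¹ * (a * (b⁻¹ * w)))))) := congrArg (fun t => (b * t)) ((r36 w).symm)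
        _ = (b⁻¹ * (b⁻¹ * (a * (b⁻¹ * w)))) := x_bB (b⁻¹ * (b⁻¹ * (a * (b⁻¹ * w))))
  have r40 : ∀ w : H, (a * (b⁻¹ * (a * (b * (b * (a⁻¹ * w)))))) = (b⁻¹ * (b⁻¹ * (a * (b * (b * w))))) := fun w => by
    calc (a * (b⁻¹ * (a * (b * (b * (a⁻¹ * w))))))
        _ = (b⁻¹ * (b⁻¹ * (b⁻¹ * (a * (b⁻¹ * (a⁻¹ * w)))))) := (r36 (a⁻¹ * w)).symm
        _ = (b⁻¹ * (b⁻¹ * (b⁻¹ * (a * (a * (b * w)))))) := congrArg (fun t => (b⁻¹ * (b⁻¹ * (b⁻¹ * (a * t))))) (r15 w)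
        _ = (b⁻¹ * (b⁻¹ * (b⁻¹ * (a⁻¹ * (b * w))))) := congrArg (fun t => (b⁻¹ * (b⁻¹ * (b⁻¹ * t)))) (r8 (b * w))
        _ = (b⁻¹ * (b⁻¹ * (a * (b * (b * w))))) := congrArg (fun t => (b⁻¹ * (b⁻¹ * t))) (r15 (b * w))
  have r41 : ∀ w : H, (b⁻¹ * (a * (b * (b * (a⁻¹ * w))))) = (b⁻¹ * (b⁻¹ * (a * (b⁻¹ * w)))) := fun w => by
    calc (b⁻¹ * (a * (b * (b * (a⁻¹ * w)))))
        _ = (a⁻¹ * (a * (b⁻¹ * (a * (b * (b * (a⁻¹ * w))))))) := (x_Aa (b⁻¹ * (a * (b * (b * (a⁻¹ * w)))))).symm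
        _ = (a⁻¹ * (b⁻¹ * (b⁻¹ * (a * (b * (b * w)))))) := congrArg (fun t => (a⁻¹ * t)) (r40 w)
        _ = (b⁻¹ * (b⁻¹ * (a * (b⁻¹ * w)))) := r39 w
  have r44 : ∀ w : H, (a * (b * (b * (a⁻¹ * w)))) = (b⁻¹ * (a * (b⁻¹ * w))) := fun w => by
    calc (a * (b * (b * (a⁻¹ * w))))
        _ = (b * (b⁻¹ * (a * (b * (b * (a⁻¹ * w)))))) := (x_bB (a * (b * (b * (a⁻¹ * w))))).symm
        _ = (b * (b⁻¹ * (b⁻¹ * (a * (b⁻¹ * w))))) := congrArg (fun t => (b * t)) (r41 w)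
        _ = (b⁻¹ * (a * (b⁻¹ * w))) := x_bB (b⁻¹ * (a * (b⁻¹ * w)))
  have r45 : ∀ w : H, (b⁻¹ * (a * (b⁻¹ * (a * w)))) = (b⁻¹ * (a * (b⁻¹ * w))) := fun w => by
    calc (b⁻¹ * (a * (b⁻¹ * (a * w))))
        _ = (a * (b * (b * (a⁻¹ * w)))) := r18 w
        _ = (b⁻¹ * (a * (b⁻¹ * w))) := r44 w
  have r47 : ∀ w : H, (a * (b⁻¹ * (a * w))) = (a * (b⁻¹ * w)) := fun w => by
    calc (a * (b⁻¹ * (a * w)))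
        _ = (b * (b⁻¹ * (a * (b⁻¹ * (a * w))))) := (x_bB (a * (b⁻¹ * (a * w)))).symm
        _ = (b * (b⁻¹ * (a * (b⁻¹ * w)))) := congrArg (fun t => (b * t)) (r45 w)
        _ = (a * (b⁻¹ * w)) := x_bB (a * (b⁻¹ * w))
  have r49 : ∀ w : H, (b⁻¹ * (b⁻¹ * (b⁻¹ * (a * (b⁻¹ * w))))) = (a * (b * w)) := fun w => by
    calc (b⁻¹ * (b⁻¹ * (b⁻¹ * (a * (b⁻¹ * w)))))
        _ = (a * (b⁻¹ * (a * (b * (b * w))))) := r36 w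
        _ = (a * (b⁻¹ * (b * (b * w)))) := r47 (b * (b * w))
        _ = (a * (b * w)) := congrArg (fun t => (a * t)) (x_Bb (b * w))
  have r51 : ∀ w : H, (b⁻¹ * (a * w)) = (b⁻¹ * w) := fun w => by
    calc (b⁻¹ * (a * w))
        _ = (a⁻¹ * (a * (b⁻¹ * (a * w)))) := (x_Aa (b⁻¹ * (a * w))).symm
        _ = (a⁻¹ * (a * (b⁻¹ * w))) := congrArg (fun t => (a⁻¹ * t)) (r47 w)
        _ = (b⁻¹ * w) := x_Aa (b⁻¹ * w)
  have r52 : ∀ w : H, (a * (b * (a⁻¹ * w))) = (b⁻¹ * w) := fun w => by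
    calc (a * (b * (a⁻¹ * w)))
        _ = (b⁻¹ * (a * w)) := r16 w
        _ = (b⁻¹ * w) := r51 w
  have r53 : ∀ w : H, (b * (b * (b * (a⁻¹ * (b⁻¹ * w))))) = (b⁻¹ * (b⁻¹ * (b⁻¹ * w))) := fun w => by
    calc (b * (b * (b * (a⁻¹ * (b⁻¹ * w)))))
        _ = (b⁻¹ * (b⁻¹ * (b⁻¹ * (a * w)))) := r24 w
        _ = (b⁻¹ * (b⁻¹ * (b⁻¹ * w))) := congrArg (fun t => (b⁻¹ * (b⁻¹ * t))) (r51 w)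
  have r54 : ∀ w : H, (a * (b * (b * (a⁻¹ * w)))) = (b⁻¹ * (b⁻¹ * w)) := fun w => by
    calc (a * (b * (b * (a⁻¹ * w))))
        _ = (b⁻¹ * (a * (b⁻¹ * w))) := r44 w
        _ = (b⁻¹ * (b⁻¹ * w)) := r51 (b⁻¹ * w)
  have r55 : ∀ w : H, (b * (b * (b * w))) = (a * (b * w)) := fun w => by
    calc (b * (b * (b * w)))
        _ = (b⁻¹ * (b⁻¹ * (b⁻¹ * (b⁻¹ * w)))) := (r23 w).symm
        _ = (b⁻¹ * (b⁻¹ * (b⁻¹ * (a * (b⁻¹ * w))))) := congrArg (fun t => (b⁻¹ * (b⁻¹ * t))) ((r51 (b⁻¹ * w)).symm)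
        _ = (a * (b * w)) := r49 w
  have r56 : ∀ w : H, (b⁻¹ * (b⁻¹ * (b⁻¹ * (b⁻¹ * w)))) = (a * (b * w)) := fun w => by
    calc (b⁻¹ * (b⁻¹ * (b⁻¹ * (b⁻¹ * w))))
        _ = (b * (b * (b * w))) := r23 w
        _ = (a * (b * w)) := r55 w
  have r57 : ∀ w : H, (b⁻¹ * (b⁻¹ * (b⁻¹ * w))) = (b⁻¹ * (b⁻¹ * w)) := fun w => by
    calc (b⁻¹ * (b⁻¹ * (b⁻¹ * w)))
        _ = (b * (b * (b * (a⁻¹ * (b⁻¹ * w))))) := (r53 w).symm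
        _ = (a * (b * (a⁻¹ * (b⁻¹ * w)))) := r55 (a⁻¹ * (b⁻¹ * w))
        _ = (b⁻¹ * (b⁻¹ * w)) := r52 (b⁻¹ * w)
  have r58 : ∀ w : H, (b⁻¹ * (b⁻¹ * w)) = (a * (b * w)) := fun w => by
    calc (b⁻¹ * (b⁻¹ * w))
        _ = (b⁻¹ * (b⁻¹ * (b⁻¹ * w))) := (r57 w).symm
        _ = (b⁻¹ * (b⁻¹ * (b⁻¹ * (b⁻¹ * w)))) := (r57 (b⁻¹ * w)).symm
        _ = (a * (b * w)) := r56 w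
  have r59 : ∀ w : H, (a * (b * (b * (a⁻¹ * w)))) = (a * (b * w)) := fun w => by
    calc (a * (b * (b * (a⁻¹ * w))))
        _ = (b⁻¹ * (b⁻¹ * w)) := r54 w
        _ = (a * (b * w)) := r58 w
  have r60 : ∀ w : H, (a * (b * w)) = (a * w) := fun w => by
    calc (a * (b * w))
        _ = (b⁻¹ * (b⁻¹ * w)) := (r58 w).symm
        _ = (b⁻¹ * (b⁻¹ * (b⁻¹ * w))) := (r57 w).symm
        _ = (a * (b * (b⁻¹ * w))) := r58 (b⁻¹ * w)
        _ = (a * w) := congrArg (fun t => (a * t)) (x_bB w)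
  have r64 : ∀ w : H, (a * w) = w := fun w => by
    calc (a * w)
        _ = (a * (b * w)) := (r60 w).symm
        _ = (a * (b * (b * (a⁻¹ * w)))) := (r59 w).symm
        _ = (a * (b * (a⁻¹ * w))) := r60 (b * (a⁻¹ * w))
        _ = (a * (a⁻¹ * w)) := r60 (a⁻¹ * w)
        _ = w := x_aA w
  have r70 : ∀ w : H, (b * w) = w := fun w => by
    calc (b * w)
        _ = (a * (b * w)) := (r64 (b * w)).symm
        _ = (a * w) := r60 w
        _ = w := r64 w
  have fin_a : ∀ w : H, (a * w) = w := fun w => by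
    calc (a * w)
        _ = w := r64 w
  have fin_b : ∀ w : H, (b * w) = w := fun w => by
    calc (b * w)
        _ = w := r70 w
  exact ⟨by simpa using fin_a 1, by simpa using fin_b 1⟩

end killC

/-! ### 2. Abelian collapse and the lift from `Δ` to `Γ̃` -/

/-- An abelian `(2,3,7)`-pair is trivial: `ab = ba`, `a³ = abab = b⁷ (= z)` force `a = b = 1`. -/
theorem SoloInformed_comm237_collapse {G : Type*} [Group G] {a b z : G} (hab : a * b = b * a)
    (r0 : a * a * a = z) (r1 : a * b * a * b = z) (r2 : b * b * b * b * b * b * b = z) :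
    a = 1 ∧ b = 1 := by
  have e1 : a * a * (b * b) = a * a * a := by
    rw [r0, ← r1]
    simp only [mul_assoc]
    rw [← mul_assoc b a b, ← hab, mul_assoc a b b]
  have hbb : b * b = a := mul_left_cancel e1
  have e2 : b * b * b * b * b * b * b = b * b * b * b * b * b * 1 := by
    rw [mul_one, r2, ← r0, ← hbb]
    simp only [mul_assoc]
  have hb : b = 1 := mul_left_cancel e2
  refine ⟨?_, hb⟩
  rw [← hbb, hb, mul_one]

/-- `c = b⁻³ a b⁻¹ a b⁻³ a` is a WEIGHT ELEMENT of `Γ̃ = ⟨a, b ∣ a³ = (ab)² = b⁷⟩ = π₁Σ(2,3,7)`: in any group,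
`a³ = abab = b⁷ = z` and `c = 1` force `a = b = z = 1` (the lifted pretzel knot `K̃ ⊂ Σ(2,3,7)` normally generates `π₁`). -/
theorem SoloInformed_gammaTilde_killC {G : Type*} [Group G] {a b z : G}
    (r0 : a * a * a = z) (r1 : a * b * a * b = z) (r2 : b * b * b * b * b * b * b = z)
    (hc : b⁻¹ * b⁻¹ * b⁻¹ * a * b⁻¹ * a * b⁻¹ * b⁻¹ * b⁻¹ * a = 1) : a = 1 ∧ b = 1 ∧ z = 1 := by
  have za : a * z = z * a := SoloInformed_anchor_za r0
  have zb : b * z = z * b := SoloInformed_anchor_zb r0 r1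
  -- the centralizer of `z` contains `a`, `b`, `z`
  let C : Subgroup G := Subgroup.centralizer ({z} : Set G)
  have memC : ∀ {x : G}, x * z = z * x → x ∈ C := by
    intro x hx
    rw [Subgroup.mem_centralizer_iff]
    intro h hh
    rw [Set.mem_singleton_iff] at hh
    subst hh
    exact hx.symm
  have ha : a ∈ C := memC za
  have hb : b ∈ C := memC zb
  have hz : z ∈ C := memC rfl
  let a' : C := ⟨a, ha⟩
  let b' : C := ⟨b, hb⟩
  let z' : C := ⟨z, hz⟩
  -- `z'` is central in `C`
  have hz' : z' ∈ Subgroup.center C := by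
    rw [Subgroup.mem_center_iff]
    intro g
    apply Subtype.ext
    have hg := (Subgroup.mem_centralizer_iff.mp g.2) z rfl
    simpa [z'] using hg.symm
  -- pass to `Q = C ⧸ Z(C)`, where `z' ↦ 1`
  let π : C →* C ⧸ Subgroup.center C := QuotientGroup.mk' (Subgroup.center C)
  have hπz : π z' = 1 := by
    rw [QuotientGroup.mk'_apply, QuotientGroup.eq_one_iff]; exact hz'
  have r0C : a' * a' * a' = z' := Subtype.ext r0
  have r1C : a' * b' * a' * b' = z' := Subtype.ext r1
  have r2C : b' * b' * b' * b' * b' * b' * b' = z' := Subtype.ext r2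
  have hcC : (b')⁻¹ * (b')⁻¹ * (b')⁻¹ * (a') * (b')⁻¹ * (a') * (b')⁻¹ * (b')⁻¹ * (b')⁻¹ * (a') = 1 := Subtype.ext hc
  have r0Q : π a' * π a' * π a' = 1 := by
    have e := congrArg π r0C; simp only [map_mul] at e; rw [e, hπz]
  have r1Q : π a' * π b' * π a' * π b' = 1 := by
    have e := congrArg π r1C; simp only [map_mul] at e; rw [e, hπz]
  have r2Q : π b' * π b' * π b' * π b' * π b' * π b' * π b' = 1 := by
    have e := congrArg π r2C; simp only [map_mul] at e; rw [e, hπz]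
  have hcQ : (π b')⁻¹ * (π b')⁻¹ * (π b')⁻¹ * (π a') * (π b')⁻¹ * (π a') * (π b')⁻¹ * (π b')⁻¹ * (π b')⁻¹ * (π a') = 1 := by
    have e := congrArg π hcC; simp only [map_mul, map_inv, map_one] at e; exact e
  obtain ⟨hA, hB⟩ := SoloInformed_triangle237_killC r0Q r1Q r2Q hcQ
  -- so `a', b'` are central in `C`; in particular `ab = ba`
  have haZ : a' ∈ Subgroup.center C := by
    rw [← QuotientGroup.eq_one_iff]; rw [QuotientGroup.mk'_apply] at hA; exact hA
  have hab : a * b = b * a := by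
    have e := (Subgroup.mem_center_iff.mp haZ) b'
    have e' := congrArg Subtype.val e
    simpa [a', b'] using e'.symm
  obtain ⟨h1a, h1b⟩ := SoloInformed_comm237_collapse hab r0 r1 r2
  refine ⟨h1a, h1b, ?_⟩
  rw [← r0, h1a, mul_one, mul_one]

/-- PRESENTATION-LEVEL `π₁(𝔐₀) = 1`: in any group, `a³ = abab = b⁷ = z` together with `[c, a] = [c, b] = 1` for
`c = b⁻³ a b⁻¹ a b⁻³ a` force `a = b = 1`; i.e. `Γ̃ / ⟨⟨[c, Γ̃]⟩⟩ = 1`, the fundamental group of the open book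
`X(Push(c)) / X(Push(c)·τ_∂)` with page `Σ(2,3,7)°` (= `{S⁴, 𝔐₀}`, HKM24 Cor. 3.6 / C626) computed from the presentation. -/
theorem SoloInformed_pi1_openBook_c_trivial {G : Type*} [Group G] {a b z : G}
    (r0 : a * a * a = z) (r1 : a * b * a * b = z) (r2 : b * b * b * b * b * b * b = z)
    (hca : (b⁻¹ * b⁻¹ * b⁻¹ * a * b⁻¹ * a * b⁻¹ * b⁻¹ * b⁻¹ * a) * a = a * (b⁻¹ * b⁻¹ * b⁻¹ * a * b⁻¹ * a * b⁻¹ * b⁻¹ * b⁻¹ * a))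
    (hcb : (b⁻¹ * b⁻¹ * b⁻¹ * a * b⁻¹ * a * b⁻¹ * b⁻¹ * b⁻¹ * a) * b = b * (b⁻¹ * b⁻¹ * b⁻¹ * a * b⁻¹ * a * b⁻¹ * b⁻¹ * b⁻¹ * a)) : a = 1 ∧ b = 1 := by
  -- the centralizer of `c` contains `a`, `b`, hence `z` and `c`
  let C : Subgroup G := Subgroup.centralizer ({b⁻¹ * b⁻¹ * b⁻¹ * a * b⁻¹ * a * b⁻¹ * b⁻¹ * b⁻¹ * a} : Set G)
  have memC : ∀ {x : G}, (b⁻¹ * b⁻¹ * b⁻¹ * a * b⁻¹ * a * b⁻¹ * b⁻¹ * b⁻¹ * a) * x = x * (b⁻¹ * b⁻¹ * b⁻¹ * a * b⁻¹ * a * b⁻¹ * b⁻¹ * b⁻¹ * a) → x ∈ C := by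
    intro x hx
    rw [Subgroup.mem_centralizer_iff]
    intro h hh
    rw [Set.mem_singleton_iff] at hh
    subst hh
    exact hx
  have ha : a ∈ C := memC hca
  have hb : b ∈ C := memC hcb
  have hz : z ∈ C := by rw [← r0]; exact C.mul_mem (C.mul_mem ha ha) ha
  let a' : C := ⟨a, ha⟩
  let b' : C := ⟨b, hb⟩
  let z' : C := ⟨z, hz⟩
  -- the word `c` on `a', b'` is central in `C`
  have hc' : ((b')⁻¹ * (b')⁻¹ * (b')⁻¹ * (a') * (b')⁻¹ * (a') * (b')⁻¹ * (b')⁻¹ * (b')⁻¹ * (a')) ∈ Subgroup.center C := by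
    rw [Subgroup.mem_center_iff]
    intro g
    apply Subtype.ext
    have hg := (Subgroup.mem_centralizer_iff.mp g.2) (b⁻¹ * b⁻¹ * b⁻¹ * a * b⁻¹ * a * b⁻¹ * b⁻¹ * b⁻¹ * a) rfl
    simpa [a', b'] using hg.symm
  let π : C →* C ⧸ Subgroup.center C := QuotientGroup.mk' (Subgroup.center C)
  have hπc : π ((b')⁻¹ * (b')⁻¹ * (b')⁻¹ * (a') * (b')⁻¹ * (a') * (b')⁻¹ * (b')⁻¹ * (b')⁻¹ * (a')) = 1 := by
    rw [QuotientGroup.mk'_apply, QuotientGroup.eq_one_iff]; exact hc'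
  have r0C : a' * a' * a' = z' := Subtype.ext r0
  have r1C : a' * b' * a' * b' = z' := Subtype.ext r1
  have r2C : b' * b' * b' * b' * b' * b' * b' = z' := Subtype.ext r2
  have r0Q : π a' * π a' * π a' = π z' := by
    have e := congrArg π r0C; simp only [map_mul] at e; exact e
  have r1Q : π a' * π b' * π a' * π b' = π z' := by
    have e := congrArg π r1C; simp only [map_mul] at e; exact e
  have r2Q : π b' * π b' * π b' * π b' * π b' * π b' * π b' = π z' := by
    have e := congrArg π r2C; simp only [map_mul] at e; exact e
  have hcQ : (π b')⁻¹ * (π b')⁻¹ * (π b')⁻¹ * (π a') * (π b')⁻¹ * (π a') * (π b')⁻¹ * (π b')⁻¹ * (π b')⁻¹ * (π a') = 1 := by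
    have e := hπc; simp only [map_mul, map_inv] at e; exact e
  obtain ⟨hA, hB, -⟩ := SoloInformed_gammaTilde_killC r0Q r1Q r2Q hcQ
  have haZ : a' ∈ Subgroup.center C := by
    rw [← QuotientGroup.eq_one_iff]; rw [QuotientGroup.mk'_apply] at hA; exact hA
  have hab : a * b = b * a := by
    have e := (Subgroup.mem_center_iff.mp haZ) b'
    have e' := congrArg Subtype.val e
    simpa [a', b'] using e'.symm
  exact SoloInformed_comm237_collapse hab r0 r1 r2

end Summit.SmoothPoincare4.SmoothPoincare4.Theorems
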